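import Literature.IUT.LogVolume.TensorPacketShellHull
import Literature.IUT.LogVolume.UnitLogVolume
import HarnessLib

/-!
# The hull defect of `log_p(R^×)` in one local field: `0 ≤ δ_K := log‖z^max‖ − μ^log(log_p(R^×)) = log‖z^max‖ +
# {1/e + m/(ef)}·log p`; tame: `δ_K = 0` ([IUTchIV] Prop. 1.2 (i), Prop. 1.4 (ii); Dupuy–Hilado §4.12)

abc-iut cell, prover seat abc-iut-w5-d082 (item XXVIIc-window of `HOME/skel/FORK-REAL-MODEL.md` §4). Per-factor companion
of `TensorPacketShellDefect`: there the hull defect of the log-shell lattice of a packet was decomposed as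
`δ_Λ = Σ_i δ_i + (−log μ̄(R_I))` with `δ_i := log‖z_i^max‖ + {1/e_i + m_i/(e_i f_i)}·log p` (`z_i^max` an element of largest
norm in `log_p(R_i^×)`, `p^{m_i} = #μ_{p^∞}(k_i)`). HERE, for ONE field `K`:

* `normalizedLocalLogVolume_logUnits_le_log_norm`: `μ^log(log_p(R^×)) ≤ log‖z^max‖` in the degree-`ef` normalisation
  (`log_p(R^×) ⊆ z^max·R = 𝔪^n`, monotonicity of `μ^log`, `μ^log(𝔪^n) = −(n/e)·log p = log‖z^max‖`);
* `log_norm_add_ge_zero_of_isMaxOn`: hence **`0 ≤ δ_K = log‖z^max‖ + {1/e + m/(ef)}·log p`** ([IUTchIV] Prop. 1.4 (ii),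
  abc-iut-S8's `prop14ii_holds`) — every summand of the packet decomposition is nonnegative;
* `log_norm_add_eq_zero_of_tame`: at a TAME field (`p > 2`, `e ≤ p − 2`) `δ_K = 0` and `m = 0`: `log_p(R^×) = 𝔪` is a ball,
  `‖z^max‖ = p^{−1/e}`, so the two volume computations `μ^log(𝔪) = −(1/e)·log p` and Prop. 1.4 (ii) leave no room for the
  torsion term (that a tame field has no nontrivial `p`-power roots of unity is already in the tree:
  `Literature.IUT.LogThetaLattice.torsionPExp_eq_zero_of_absRamificationIdx_le`, not restated here).

[cite: Mochizuki2012, IUTchIV Prop. 1.2 (i) p. 10, Prop. 1.4 (ii) p. 13] [cite: DupuyHilado2025, §4.12] Classical; nothing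
here takes a side on [IUTchIII] Cor. 3.12. PROOF-ONLY file: no definitions, no named `Prop` facts.
-/

noncomputable section

open MeasureTheory Set Metric
open scoped ENNReal NormedField

namespace Literature.IUT.LogVolume

variable (p : ℕ) [Fact p.Prime]
variable (K : Type) [NontriviallyNormedField K] [instK : NormedAlgebra ℚ_[p] K] [IsUltrametricDist K] [ProperSpace K]

include p in
/-- A nonzero `z ∈ K` has `‖z‖ = ‖ϖ‖^n` for the chosen uniformizer and some `n ∈ ℤ` (value group `p^{(1/e)ℤ}`).
[cite: Mochizuki2012, IUTchIV Prop. 1.2 p. 10] -/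
theorem exists_norm_eq_norm_unifChoice_zpow {z : K} (hz : z ≠ 0) :
    ∃ n : ℤ, ‖z‖ = ‖(unifChoice K : K)‖ ^ n := by
  obtain ⟨n, hn⟩ := exists_norm_eq_rpow p K hz
  refine ⟨n, ?_⟩
  have hp0 : (0 : ℝ) ≤ p := by exact_mod_cast (Fact.out : p.Prime).pos.le
  rw [hn, norm_eq_rpow_of_isUniformizer p K (isUniformizer_unifChoice K), ← Real.rpow_intCast,
    ← Real.rpow_mul hp0]
  congr 1
  ring

variable [MeasurableSpace K] [BorelSpace K]

/-- **`μ^log(log_p(R^×)) ≤ log‖z^max‖`** (degree-`ef` normalisation) for an element `z^max` of largest norm in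
`log_p(R^×)`: `log_p(R^×) ⊆ closedBall 0 ‖z^max‖ = 𝔪^n` and `μ^log(𝔪^n) = −(n/e)·log p = log‖z^max‖`.
[cite: Mochizuki2012, IUTchIV Prop. 1.4 (i)(ii) p. 13] -/
theorem normalizedLocalLogVolume_logUnits_le_log_norm {z : K} (hz : ∀ w ∈ logUnits K, ‖w‖ ≤ ‖z‖) :
    normalizedLocalLogVolume K (absRamificationIdx p K * residueDegree p K) (logUnits K) ≤ Real.log ‖z‖ := by
  have hz0 := ne_zero_of_isMaxOn_logUnits p K hz
  obtain ⟨n, hn⟩ := exists_norm_eq_norm_unifChoice_zpow p K hz0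
  have hsub : logUnits K ⊆ closedBall (0 : K) (‖(unifChoice K : K)‖ ^ n) := fun w hw => by
    rw [mem_closedBall, dist_zero_right, ← hn]
    exact hz w hw
  have hpos : 0 < (unitBallStructure K).haar (logUnits K) :=
    (unitBallStructure K).haar_pos_of_isOpen (isOpen_logUnits p K) ⟨0, zero_mem_logUnits (p := p)⟩
  have hfin : (unitBallStructure K).haar (closedBall (0 : K) (‖(unifChoice K : K)‖ ^ n)) < ∞ :=
    (unitBallStructure K).haar_lt_top_of_isCompact (isCompact_closedBall _ _)
  have hmono := (unitBallStructure K).normalizedLogVolume_mono (absRamificationIdx p K * residueDegree p K)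
    hpos hfin hsub
  have hball := normalizedLocalLogVolume_closedBall_zpow K (isUniformizer_unifChoice K) (residueCard_eq_pow p K)
    (absRamificationIdx p K * residueDegree p K) n
  have hlog : Real.log ‖z‖ = -((n : ℝ) / absRamificationIdx p K) * Real.log p := by
    have hp0 : (0 : ℝ) < p := by exact_mod_cast (Fact.out : p.Prime).pos
    rw [hn, norm_eq_rpow_of_isUniformizer p K (isUniformizer_unifChoice K), ← Real.rpow_intCast,
      ← Real.rpow_mul hp0.le, Real.log_rpow hp0]
    ring
  have he : (0 : ℝ) < absRamificationIdx p K := by exact_mod_cast absRamificationIdx_pos p K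
  have hf : (0 : ℝ) < residueDegree p K := by exact_mod_cast residueDegree_pos p K
  have hval : normalizedLocalLogVolume K (absRamificationIdx p K * residueDegree p K)
      (closedBall (0 : K) (‖(unifChoice K : K)‖ ^ n)) = Real.log ‖z‖ := by
    rw [hball, hlog]
    push_cast
    field_simp
  calc normalizedLocalLogVolume K (absRamificationIdx p K * residueDegree p K) (logUnits K)
      ≤ normalizedLocalLogVolume K (absRamificationIdx p K * residueDegree p K)
          (closedBall (0 : K) (‖(unifChoice K : K)‖ ^ n)) := hmono
    _ = Real.log ‖z‖ := hval

/-- **`0 ≤ δ_K = log‖z^max‖ + {1/e + m/(ef)}·log p`**: the hull defect of `log_p(R^×)` in `K` is nonnegative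
([IUTchIV] Prop. 1.4 (ii) evaluates `μ^log(log_p(R^×)) = −{1/e + m/(ef)}·log p`).
[cite: Mochizuki2012, IUTchIV Prop. 1.4 (ii) p. 13] -/
theorem log_norm_add_ge_zero_of_isMaxOn {z : K} (hz : ∀ w ∈ logUnits K, ‖w‖ ≤ ‖z‖) :
    0 ≤ Real.log ‖z‖ + (1 / (absRamificationIdx p K : ℝ) +
      (torsionPExp p K : ℝ) / ((absRamificationIdx p K : ℝ) * residueDegree p K)) * Real.log p := by
  have h := normalizedLocalLogVolume_logUnits_le_log_norm p K hz
  have h14 := prop14ii_holds p K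
  unfold Prop14ii at h14
  rw [h14] at h
  linarith

/-- **Tame: `δ_K = 0`** (`p > 2`, `e ≤ p − 2`): `‖z^max‖ = p^{−1/e}` and `log_p(R^×) = 𝔪`, so `log‖z^max‖ = −(1/e)·log p` while
`δ_K = (m/(ef))·log p ≥ 0` — together these give `δ_K = 0`. [cite: Mochizuki2012, IUTchIV Prop. 1.2 (i) p. 10, Prop. 1.4 (ii) p. 13] -/
theorem log_norm_add_eq_zero_of_tame (hp : 2 < p) (he : absRamificationIdx p K ≤ p - 2) {z : K}
    (hzmem : z ∈ logUnits K) (hz : ∀ w ∈ logUnits K, ‖w‖ ≤ ‖z‖) :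
    Real.log ‖z‖ + (1 / (absRamificationIdx p K : ℝ) +
      (torsionPExp p K : ℝ) / ((absRamificationIdx p K : ℝ) * residueDegree p K)) * Real.log p = 0 := by
  have hp0 : (0 : ℝ) < p := by exact_mod_cast (Fact.out : p.Prime).pos
  have hlogp : 0 < Real.log p := Real.log_pos (by exact_mod_cast (Fact.out : p.Prime).one_lt)
  have hge := log_norm_add_ge_zero_of_isMaxOn p K hz
  have hnorm := norm_eq_of_isMaxOn_logUnits_of_tame p K hp he hzmem hz
  have hlog : Real.log ‖z‖ = -(1 / (absRamificationIdx p K : ℝ)) * Real.log p := by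
    rw [hnorm, Real.log_rpow hp0]
  -- the volume of `log_p(R^×) = 𝔪` is `−(1/e)·log p`, so `m/(ef)·log p ≤ 0`
  have he1 := absRamificationIdx_pos p K
  have hball : logUnits K = closedBall (0 : K) (‖(unifChoice K : K)‖ ^ (1 : ℤ)) := by
    obtain ⟨h1, -⟩ := prop12iEq_holds p K hp he
    rw [← h1, zpow_one, norm_eq_rpow_of_isUniformizer p K (isUniformizer_unifChoice K),
      logRadiusA_eq hp he1 he]
    ext x
    rw [mem_pBall_iff, mem_closedBall, dist_zero_right]
  have hvol : normalizedLocalLogVolume K (absRamificationIdx p K * residueDegree p K) (logUnits K) =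
      -(1 / (absRamificationIdx p K : ℝ)) * Real.log p := by
    rw [hball, normalizedLocalLogVolume_closedBall_zpow K (isUniformizer_unifChoice K) (residueCard_eq_pow p K)]
    have he' : (0 : ℝ) < absRamificationIdx p K := by exact_mod_cast he1
    have hf : (0 : ℝ) < residueDegree p K := by exact_mod_cast residueDegree_pos p K
    push_cast
    field_simp
  have h14 := prop14ii_holds p K
  unfold Prop14ii at h14
  rw [h14] at hvol
  -- from `hvol`: the torsion term vanishes
  have he' : (0 : ℝ) < absRamificationIdx p K := by exact_mod_cast he1
  have hf : (0 : ℝ) < residueDegree p K := by exact_mod_cast residueDegree_pos p K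
  have hm0 : (torsionPExp p K : ℝ) / ((absRamificationIdx p K : ℝ) * residueDegree p K) * Real.log p = 0 := by
    nlinarith
  rw [hlog]
  nlinarith

end Literature.IUT.LogVolume

end
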